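import Summits.QuantumFields.BalabanUV.Beta.GAN24.SoftColumnGradKingOneStep
import Summits.QuantumFields.BalabanUV.Beta.GAN24.SoftColumnKernelDecay
import Summits.QuantumFields.BalabanUV.Beta.GAN24.GradientVertexChainKing

/-!
# `BalabanUV.Beta.GAN24.SoftColumnGradKernelDecay` — binder row G-an2-4 ∕ (CONV-C), route R7, road P2: the GRADIENT OF THE SOFT COLUMN `∂_ν(𝒢Q*)`
# in (CONV-C)'s literal two-clause KERNEL shape (fine bond × unit bond, King's parent), `a = 1`, cubic unit tori, along `n_k = L^k` — the gradient
# twin of gan24-p3-g27's `SoftColumnKernelDecay.colOp_two_clauses_cubic`: rows of `∂H` (b05 decay ∕ this lineage's `norm_dker_par_sub_le_lev`)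
# × road P2's kernel laws for `c`, `c′ − c` through `BlockFieldDecay.fieldDecay_mulVec`; makes `∂(𝒢Q*)` a LEG with both letters for `chain2`∕`chain3`

NOT IN PRINT; OUR PROOF ATTEMPT (unit `b2b-balaban-gan24-p2`, gen 31 = prover-b2b-balaban-gan24-p2-g31-0, road-P2 chair of row G-an2-4;
CRUX TEAM (2) under the ruling «YM REDIRECT TOWARDS THE SUMMIT», 2026-08-21).  HONEST FRAMING (cell contract, verbatim): «discharging
`BetaPertH` makes Bałaban's UV stability UNCONDITIONAL — a real constructive-QFT result; it is NOT the continuum limit and NOT the Clay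
problem.»  HONEST DEPENDENCY (verbatim): «continuum YM on T⁴ ⇐ BetaPertH ∧ nine spine estimates (0/9 proved); BetaPertH ⇐ (D1) ∧ (D4) ∧
CAP+tail; G-an2-4 gates asym, D1 and NE2/3/4.»  ABSOLUTE RULE: nothing printed is a hypothesis; no `def … : Prop`, no `sorry`; [folklore]
bookkeeping BY NAME (`HkGradientKingRate`, `SoftColumnGradKingOneStep`, `GradientVertexChainKing.norm_dker_le_block`, p3's `SoftColumnKernelDecay`
(`col`, `mul_apply_eq_mulVec_col`), road P2's `AveragedPropagatorDecayCubic`, gen-29 `BlockFieldDecay`, leaf-04 `SoftColumnTwoLevel`).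

## Content (0 sorry; `a = 1`, cubic unit tori `T = fun _ => N₀`, `L ≥ 2`)
 * §1 `DH n ν := fdiff·Hk` (the gradient of `H_k` as a matrix); `rowDecay_DH` (every torus), `rowDecay_DH_sub_stairV_lev` (tower, `CG·θG^k`),
   `fdiff_colOp_sub_eq` (`∂′colOp′ − stairV·(∂colOp) = DH′·(c′ − c) + (DH′ − stairV·DH)·c` as matrices).
 * §2 **`dcolOp_two_clauses_cubic`**: `∃ K δ > 0`: (i) `‖(∂_ν^{(n)}colOp_n)(X,q)‖ ≤ K·e^{−δ|ȳ(X)−ȳ(q)|}` every level; (ii)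
   `‖(∂_ν^{(n_{k+1})}colOp_{k+1})(X′,q) − (∂_ν^{(n_k)}colOp_k)(parT X′,q)‖ ≤ K·(ε_k + θG(L,½)^k)·e^{−δ|ȳ(X′)−ȳ(q)|}`,
   `ε_k = ((L−1)∕(L·n_k))·(2 + log(L·n_k) + log n_k)` (road P2's `c′ − c` kernel rate).
HONEST.  a = 1 CUBIC only (road P2's kernel letters); exponent `L^{−1∕4}` from the gradient leg; U = 1; NOT (CONV-C) as typed, NEVER «G-an2-4 closed»,
NOT NE2, NOT D1, NOT BetaPertH, NOT continuum, NOT Clay.  Text locations only: [Balaban1984PropagatorsI] (1.31) p. 23, (1.63) p. 28, (1.103) p. 35.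
-/

noncomputable section

open scoped BigOperators Matrix
open Finset

namespace Summit.QuantumFields.BalabanUV.Beta.GAN24.SoftColumnGradKernelDecay

open Literature.MathematicalPhysics.QuantumFieldTheory.Balaban1983to89
open Literature.MathematicalPhysics.QuantumFieldTheory.Balaban1983to89.B5Prop11Plancherel (Tor fine fdiff)
open Literature.MathematicalPhysics.QuantumFieldTheory.Balaban1983to89.B4TorusKernel.MultiPeriod (torusSupNorm)
open Literature.MathematicalPhysics.QuantumFieldTheory.Balaban1983to89.B4Sect5Proof (latticeConst latticeConst_nonneg)
open Literature.MathematicalPhysics.QuantumFieldTheory.Balaban1983to89.B5Blocks16 (blockOf)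
open Literature.MathematicalPhysics.QuantumFieldTheory.Balaban1983to89.B6LowerBound2153Torus (toT rep toT_rep)
open Literature.MathematicalPhysics.QuantumFieldTheory.Balaban1983to89.B5G183RateUnitTower (lev lev_neZero)
open Literature.MathematicalPhysics.QuantumFieldTheory.Balaban1983to89.B5Hk163Form166 (HkOp_eq_Hk)
open Literature.MathematicalPhysics.QuantumFieldTheory.Balaban1983to89.B5Hk163TorusHolder (dker)
open Literature.MathematicalPhysics.QuantumFieldTheory.Balaban1983to89.B5Hk163TorusHolderDecay (CdecD CdecD_nonneg)
open Literature.MathematicalPhysics.QuantumFieldTheory.Balaban1983to89.Beta.FluctuationProjection (Hk)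
open Summit.QuantumFields.BalabanUV.T4Continuum.BalabanAveragedTowerModes (par)
open Summit.QuantumFields.BalabanUV.T4Continuum.BlockPairingGeometry (parT)
open Summit.QuantumFields.BalabanUV.T4Continuum.BalabanAveragedTowerUnit (cast_lev')
open Summit.QuantumFields.BalabanUV.Beta.GAN24.StaircaseAveragingDefect (stairV)
open Summit.QuantumFields.BalabanUV.Beta.GAN24.AveragedPropagatorTwoLevel (covOp)
open Summit.QuantumFields.BalabanUV.Beta.GAN24.SoftColumnTwoLevel (colOp)
open Summit.QuantumFields.BalabanUV.Beta.GAN24.HkStaircaseOneStep (stairV_mul_apply)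
open Summit.QuantumFields.BalabanUV.Beta.GAN24.HkKingOneStep (dec dec_pos)
open Summit.QuantumFields.BalabanUV.Beta.GAN24.HkGradientKingRate (thetaG thetaG_pos CG CG_nonneg norm_dker_par_sub_le_lev)
open Summit.QuantumFields.BalabanUV.Beta.GAN24.SoftColumnGradKingOneStep (fdiff_Hk_apply fdiff_colOp_eq)
open Summit.QuantumFields.BalabanUV.Beta.GAN24.GradientVertexChainKing (norm_dker_le_block)
open Summit.QuantumFields.BalabanUV.Beta.GAN24.BlockFieldDecay (RowDecay FieldDecay fieldDecay_mulVec)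
open Summit.QuantumFields.BalabanUV.Beta.GAN24.AveragedPropagatorDecayCubic (covOp_kernel_decay_cubic norm_covOp_succ_sub_apply_le_cubic)
open Summit.QuantumFields.BalabanUV.Beta.GAN24.SoftColumnKernelDecay (col mul_apply_eq_mulVec_col)

variable {d : ℕ}

/-! ## §1 The gradient of `H_k` as a matrix and its row decays -/

section Rows

variable (M : Fin (d + 1) → ℕ) [hM : ∀ μ, NeZero (M μ)]

/-- the gradient of `H_k` in direction `ν` as a matrix (fine bonds × unit bonds); entries = b05's `dker` (`fdiff_Hk_apply`, at `a = 1`). [folklore] -/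
def DH (n : ℕ) [NeZero n] (ν : Fin (d + 1)) : Matrix (Tor (fine n M) × Fin (d + 1)) (Tor M × Fin (d + 1)) ℂ :=
  fdiff (fine n M) (n : ℂ) ν * Hk n (Nat.one_le_iff_ne_zero.mpr (NeZero.ne n)) M 1 one_pos

/-- `DH n ν X j = dker n M X.2 j.2 ν X.1 j.1`. [folklore] -/
theorem DH_apply (n : ℕ) [NeZero n] (ν : Fin (d + 1)) (X : Tor (fine n M) × Fin (d + 1)) (j : Tor M × Fin (d + 1)) :
    DH M n ν X j = dker n M X.2 j.2 ν X.1 j.1 :=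
  fdiff_Hk_apply n M 1 one_pos ν X j

/-- **row decay of `∂H`** (every torus, every level): `Σ_λ ‖∂_νH_n(X,(y′,λ))‖ ≤ (d+1)·CdecD(d)·e^{−dec|ȳ(X) − ȳ(y′)|}`. [folklore] -/
theorem rowDecay_DH (n : ℕ) [NeZero n] (ν : Fin (d + 1)) :
    RowDecay M (fun X : Tor (fine n M) × Fin (d + 1) => blockOf n M X.1) (fun i : Tor M × Fin (d + 1) => i.1) (DH M n ν)
      ((d + 1) * CdecD d) (dec d) := by
  intro X y'
  have hterm : ∀ lam : Fin (d + 1), ‖DH M n ν X (y', lam)‖ ≤ CdecD d * Real.exp (-(dec d * torusSupNorm M (rep M (blockOf n M X.1) - rep M y'))) := by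
    intro lam
    rw [DH_apply]
    have h := norm_dker_le_block n M X.2 lam ν X.1 (rep M y')
    rw [toT_rep] at h
    exact h
  rw [Fintype.sum_prod_type]
  dsimp only
  calc ∑ y : Tor M, ∑ lam : Fin (d + 1), (if y = y' then ‖DH M n ν X (y, lam)‖ else 0)
      = ∑ lam : Fin (d + 1), ‖DH M n ν X (y', lam)‖ := by
        rw [Finset.sum_comm]
        exact Finset.sum_congr rfl fun lam _ => by rw [Finset.sum_ite_eq' Finset.univ y', if_pos (Finset.mem_univ _)]
    _ ≤ ∑ _lam : Fin (d + 1), CdecD d * Real.exp (-(dec d * torusSupNorm M (rep M (blockOf n M X.1) - rep M y'))) :=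
        Finset.sum_le_sum fun lam _ => hterm lam
    _ = (d + 1) * CdecD d * Real.exp (-(dec d * torusSupNorm M (rep M (blockOf n M X.1) - rep M y'))) := by
        simp only [Finset.sum_const, Finset.card_univ, Fintype.card_fin, nsmul_eq_mul]; push_cast; ring

/-- **row decay of the gradient leg's one-step difference along the tower** (`L ≥ 2`): `Σ_λ ‖(∂H_{k+1} − stairV·∂H_k)(X′,(y′,λ))‖ ≤ (d+1)·CG·θG^k·e^{…}`.
[folklore] -/
theorem rowDecay_DH_sub_stairV_lev (L : ℕ) [NeZero L] (hL : 2 ≤ L) (k : ℕ) (ν : Fin (d + 1)) :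
    RowDecay M (fun X : Tor (fine (L * lev L k) M) × Fin (d + 1) => blockOf (L * lev L k) M X.1) (fun i : Tor M × Fin (d + 1) => i.1)
      (DH M (L * lev L k) ν - stairV (lev L k) L M * DH M (lev L k) ν) ((d + 1) * (CG d (1/2) L * thetaG L (1/2) ^ k)) (dec d) := by
  intro X y'
  have hterm : ∀ lam : Fin (d + 1), ‖(DH M (L * lev L k) ν - stairV (lev L k) L M * DH M (lev L k) ν) X (y', lam)‖
      ≤ CG d (1/2) L * thetaG L (1/2) ^ k * Real.exp (-(dec d * torusSupNorm M (rep M (blockOf (L * lev L k) M X.1) - rep M y'))) := by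
    intro lam
    rw [Matrix.sub_apply, stairV_mul_apply, DH_apply, DH_apply]
    have h := norm_dker_par_sub_le_lev L M hL k X ν lam (rep M y') (α := 1/2) (by norm_num) (by norm_num)
    rw [toT_rep] at h
    exact h
  rw [Fintype.sum_prod_type]
  dsimp only
  calc ∑ y : Tor M, ∑ lam : Fin (d + 1), (if y = y' then ‖(DH M (L * lev L k) ν - stairV (lev L k) L M * DH M (lev L k) ν) X (y, lam)‖ else 0)
      = ∑ lam : Fin (d + 1), ‖(DH M (L * lev L k) ν - stairV (lev L k) L M * DH M (lev L k) ν) X (y', lam)‖ := by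
        rw [Finset.sum_comm]
        exact Finset.sum_congr rfl fun lam _ => by rw [Finset.sum_ite_eq' Finset.univ y', if_pos (Finset.mem_univ _)]
    _ ≤ ∑ _lam : Fin (d + 1), CG d (1/2) L * thetaG L (1/2) ^ k * Real.exp (-(dec d * torusSupNorm M (rep M (blockOf (L * lev L k) M X.1) - rep M y'))) :=
        Finset.sum_le_sum fun lam _ => hterm lam
    _ = (d + 1) * (CG d (1/2) L * thetaG L (1/2) ^ k) * Real.exp (-(dec d * torusSupNorm M (rep M (blockOf (L * lev L k) M X.1) - rep M y'))) := by
        simp only [Finset.sum_const, Finset.card_univ, Fintype.card_fin, nsmul_eq_mul]; push_cast; ring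

/-- the matrix split: `∂′colOp′ − stairV·(∂colOp) = DH′·(c′ − c) + (DH′ − stairV·DH)·c` (`∂·colOp = DH·c` at both levels). [folklore] -/
theorem fdiff_colOp_sub_eq (N R : ℕ) [NeZero N] [NeZero R] (ν : Fin (d + 1)) :
    fdiff (fine (R * N) M) ((R * N : ℕ) : ℂ) ν * colOp (R * N) M 1 - stairV N R M * (fdiff (fine N M) (N : ℂ) ν * colOp N M 1)
      = DH M (R * N) ν * (covOp (R * N) M 1 - covOp N M 1) + (DH M (R * N) ν - stairV N R M * DH M N ν) * covOp N M 1 := by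
  have e1 : fdiff (fine (R * N) M) ((R * N : ℕ) : ℂ) ν * colOp (R * N) M 1 = DH M (R * N) ν * covOp (R * N) M 1 :=
    fdiff_colOp_eq (R * N) M 1 one_pos ν
  have e2 : fdiff (fine N M) (N : ℂ) ν * colOp N M 1 = DH M N ν * covOp N M 1 := fdiff_colOp_eq N M 1 one_pos ν
  rw [e1, e2, ← Matrix.mul_assoc, Matrix.mul_sub, Matrix.sub_mul]
  abel

end Rows

/-! ## §2 The two-clause kernel shape, `a = 1`, cubic -/

section Cubic

/-- **THE GRADIENT OF THE SOFT COLUMN IN (CONV-C)'s TWO-CLAUSE KERNEL SHAPE (fine bond × unit bond, King's parent), `a = 1`, CUBIC, along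
`n_k = L^k` (`L ≥ 2`)**: there are `K, δ > 0` (functions of `d, L`) such that for every `N₀ ≥ 1`, every direction `ν`,
 (i) every level `n`, fine bond `X`, unit bond `q`: `‖(∂_ν^{(n)}colOp_n)(X,q)‖ ≤ K·e^{−δ·|ȳ(X) − ȳ(q)|_T}`;
 (ii) every `k`, fine bond `X′` of level `k+1`, unit bond `q`: `‖(∂_ν^{(n_{k+1})}colOp_{k+1})(X′,q) − (∂_ν^{(n_k)}colOp_k)(parT X′,q)‖ ≤ K·(ε_k + θG(L,½)^k)·e^{−δ|…|}`,
`ε_k = ((L−1)∕(L·n_k))·(2 + log(L·n_k) + log n_k)`. [cite: Balaban1984PropagatorsI, (1.31) p.23, (1.103) p.35; King1986, p.664] [folklore] -/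
theorem dcolOp_two_clauses_cubic (d L : ℕ) [NeZero L] (hL : 2 ≤ L) :
    ∃ K δ : ℝ, 0 < K ∧ 0 < δ ∧
      (∀ (n N₀ : ℕ) [NeZero n] [NeZero N₀] (ν : Fin (d + 1)) (X : Tor (fine n (fun _ : Fin (d + 1) => N₀)) × Fin (d + 1))
          (q : Tor (fun _ : Fin (d + 1) => N₀) × Fin (d + 1)),
        ‖(fdiff (fine n (fun _ : Fin (d + 1) => N₀)) (n : ℂ) ν * colOp n (fun _ : Fin (d + 1) => N₀) 1) X q‖
          ≤ K * Real.exp (-(δ * torusSupNorm (fun _ : Fin (d + 1) => N₀)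
              (rep (fun _ : Fin (d + 1) => N₀) (blockOf n (fun _ : Fin (d + 1) => N₀) X.1) - rep (fun _ : Fin (d + 1) => N₀) q.1)))) ∧
      (∀ (k N₀ : ℕ) [NeZero N₀] (ν : Fin (d + 1)) (X' : Tor (fine (L * lev L k) (fun _ : Fin (d + 1) => N₀)) × Fin (d + 1))
          (q : Tor (fun _ : Fin (d + 1) => N₀) × Fin (d + 1)),
        ‖(fdiff (fine (L * lev L k) (fun _ : Fin (d + 1) => N₀)) ((L * lev L k : ℕ) : ℂ) ν * colOp (L * lev L k) (fun _ : Fin (d + 1) => N₀) 1) X' q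
            - (fdiff (fine (lev L k) (fun _ : Fin (d + 1) => N₀)) ((lev L k : ℕ) : ℂ) ν * colOp (lev L k) (fun _ : Fin (d + 1) => N₀) 1)
                (parT (lev L k) L (fun _ : Fin (d + 1) => N₀) X') q‖
          ≤ K * ((((L : ℝ) - 1) / ((L : ℝ) * (lev L k : ℕ))) * (2 + Real.log ((L * lev L k : ℕ) : ℝ) + Real.log ((lev L k : ℕ) : ℝ))
                  + thetaG L (1/2) ^ k)
              * Real.exp (-(δ * torusSupNorm (fun _ : Fin (d + 1) => N₀)
                  (rep (fun _ : Fin (d + 1) => N₀) (blockOf (L * lev L k) (fun _ : Fin (d + 1) => N₀) X'.1)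
                    - rep (fun _ : Fin (d + 1) => N₀) q.1)))) := by
  have hL1 : 1 ≤ L := le_trans (by norm_num) hL
  obtain ⟨Kc, δc, hKc, hδc, hc⟩ := covOp_kernel_decay_cubic d
  obtain ⟨Kd, δd, hKd, hδd, hdiff⟩ := norm_covOp_succ_sub_apply_le_cubic d
  set δm : ℝ := min (dec d) (min δc δd) with hδm
  have hδm0 : 0 < δm := lt_min (dec_pos d) (lt_min hδc hδd)
  have hδm1 : δm ≤ dec d := min_le_left _ _
  have hδm2 : δm ≤ δc := (min_le_right _ _).trans (min_le_left _ _)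
  have hδm3 : δm ≤ δd := (min_le_right _ _).trans (min_le_right _ _)
  set CH : ℝ := (d + 1) * CdecD d with hCH
  have hCH0 : 0 ≤ CH := by have : 0 ≤ CdecD d := CdecD_nonneg; rw [hCH]; positivity
  set CK : ℝ := ((d : ℝ) + 1) * CG d (1/2) L with hCK
  have hCK0 : 0 ≤ CK := by have := CG_nonneg d (1/2) L; positivity
  set Λ : ℝ := latticeConst (d + 1) (δm / 2) with hΛ
  have hΛ0 : 0 ≤ Λ := latticeConst_nonneg _ (half_pos hδm0).le
  refine ⟨(CH * Kc + CH * Kd + CK * Kc) * Λ + 1, δm / 2, by positivity, half_pos hδm0, ?_, ?_⟩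
  · intro n N₀ _ _ ν X q
    have hrow := (rowDecay_DH (fun _ : Fin (d + 1) => N₀) n ν).mono le_rfl hCH0 hδm1
    have hcol : FieldDecay (fun _ : Fin (d + 1) => N₀) (fun i : Tor (fun _ : Fin (d + 1) => N₀) × Fin (d + 1) => i.1)
        (col (covOp n (fun _ : Fin (d + 1) => N₀) 1) q) Kc δm q.1 := by
      intro j
      refine (hc n N₀ j q).trans ?_
      have ht := B4TorusKernel.MultiPeriod.torusSupNorm_nonneg (fun i => Nat.one_le_iff_ne_zero.mpr (NeZero.ne ((fun _ : Fin (d + 1) => N₀) i)))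
        (rep (fun _ : Fin (d + 1) => N₀) j.1 - rep (fun _ : Fin (d + 1) => N₀) q.1)
      exact mul_le_mul_of_nonneg_left (Real.exp_le_exp.mpr (by nlinarith)) hKc.le
    have hF := fieldDecay_mulVec hrow hδm0 hcol hKc.le X
    have e : (fdiff (fine n (fun _ : Fin (d + 1) => N₀)) (n : ℂ) ν * colOp n (fun _ : Fin (d + 1) => N₀) 1) X q
        = (DH (fun _ : Fin (d + 1) => N₀) n ν *ᵥ col (covOp n (fun _ : Fin (d + 1) => N₀) 1) q) X := by
      rw [fdiff_colOp_eq n (fun _ : Fin (d + 1) => N₀) 1 one_pos ν, mul_apply_eq_mulVec_col]; rfl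
    rw [e]
    refine hF.trans (mul_le_mul_of_nonneg_right ?_ (Real.exp_pos _).le)
    have : CH * Kc * Λ ≤ (CH * Kc + CH * Kd + CK * Kc) * Λ := by
      apply mul_le_mul_of_nonneg_right _ hΛ0; nlinarith [mul_nonneg hCH0 hKd.le, mul_nonneg hCK0 hKc.le]
    linarith
  · intro k N₀ _ ν X' q
    have hN : 1 ≤ lev L k := Nat.one_le_iff_ne_zero.mpr (NeZero.ne (lev L k))
    have hRN : 1 ≤ L * lev L k := Nat.one_le_iff_ne_zero.mpr (NeZero.ne (L * lev L k))
    have hρ : 0 ≤ ((L : ℝ) - 1) / ((L : ℝ) * (lev L k : ℕ)) := by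
      have hR1 : (1 : ℝ) ≤ L := by exact_mod_cast hL1
      have hN0 : (0 : ℝ) < (lev L k : ℕ) := by exact_mod_cast hN
      exact div_nonneg (by linarith) (by positivity)
    have hℓ : 0 ≤ 2 + Real.log ((L * lev L k : ℕ) : ℝ) + Real.log ((lev L k : ℕ) : ℝ) := by
      have h1 : 0 ≤ Real.log ((L * lev L k : ℕ) : ℝ) := Real.log_nonneg (by exact_mod_cast hRN)
      have h2 : 0 ≤ Real.log ((lev L k : ℕ) : ℝ) := Real.log_nonneg (by exact_mod_cast hN)
      linarith
    set ε : ℝ := ((L : ℝ) - 1) / ((L : ℝ) * (lev L k : ℕ)) * (2 + Real.log ((L * lev L k : ℕ) : ℝ) + Real.log ((lev L k : ℕ) : ℝ)) with hε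
    have hε0 : 0 ≤ ε := mul_nonneg hρ hℓ
    have hθ : 0 ≤ thetaG L (1/2) ^ k := pow_nonneg (thetaG_pos hL1 _).le k
    have hrow1 := (rowDecay_DH (fun _ : Fin (d + 1) => N₀) (L * lev L k) ν).mono le_rfl hCH0 hδm1
    have hrow2 := (rowDecay_DH_sub_stairV_lev (fun _ : Fin (d + 1) => N₀) L hL k ν).mono le_rfl (mul_nonneg (by positivity) (mul_nonneg (CG_nonneg d _ L) hθ)) hδm1
    have hcol1 : FieldDecay (fun _ : Fin (d + 1) => N₀) (fun i : Tor (fun _ : Fin (d + 1) => N₀) × Fin (d + 1) => i.1)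
        (col (covOp (L * lev L k) (fun _ : Fin (d + 1) => N₀) 1 - covOp (lev L k) (fun _ : Fin (d + 1) => N₀) 1) q) (Kd * ε) δm q.1 := by
      intro j
      refine (hdiff (lev L k) L N₀ j q).trans ?_
      have ht := B4TorusKernel.MultiPeriod.torusSupNorm_nonneg (fun i => Nat.one_le_iff_ne_zero.mpr (NeZero.ne ((fun _ : Fin (d + 1) => N₀) i)))
        (rep (fun _ : Fin (d + 1) => N₀) j.1 - rep (fun _ : Fin (d + 1) => N₀) q.1)
      rw [hε, show Kd * (((L : ℝ) - 1) / ((L : ℝ) * (lev L k : ℕ))) * (2 + Real.log ((L * lev L k : ℕ) : ℝ) + Real.log ((lev L k : ℕ) : ℝ))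
          = Kd * (((L : ℝ) - 1) / ((L : ℝ) * (lev L k : ℕ)) * (2 + Real.log ((L * lev L k : ℕ) : ℝ) + Real.log ((lev L k : ℕ) : ℝ))) by ring]
      exact mul_le_mul_of_nonneg_left (Real.exp_le_exp.mpr (by nlinarith)) (mul_nonneg hKd.le hε0)
    have hcol2 : FieldDecay (fun _ : Fin (d + 1) => N₀) (fun i : Tor (fun _ : Fin (d + 1) => N₀) × Fin (d + 1) => i.1)
        (col (covOp (lev L k) (fun _ : Fin (d + 1) => N₀) 1) q) Kc δm q.1 := by
      intro j
      refine (hc (lev L k) N₀ j q).trans ?_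
      have ht := B4TorusKernel.MultiPeriod.torusSupNorm_nonneg (fun i => Nat.one_le_iff_ne_zero.mpr (NeZero.ne ((fun _ : Fin (d + 1) => N₀) i)))
        (rep (fun _ : Fin (d + 1) => N₀) j.1 - rep (fun _ : Fin (d + 1) => N₀) q.1)
      exact mul_le_mul_of_nonneg_left (Real.exp_le_exp.mpr (by nlinarith)) hKc.le
    have hF1 := fieldDecay_mulVec hrow1 hδm0 hcol1 (mul_nonneg hKd.le hε0) X'
    have hF2 := fieldDecay_mulVec hrow2 hδm0 hcol2 hKc.le X'
    -- the split, read at (X′, q)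
    have e : (fdiff (fine (L * lev L k) (fun _ : Fin (d + 1) => N₀)) ((L * lev L k : ℕ) : ℂ) ν * colOp (L * lev L k) (fun _ : Fin (d + 1) => N₀) 1) X' q
          - (fdiff (fine (lev L k) (fun _ : Fin (d + 1) => N₀)) ((lev L k : ℕ) : ℂ) ν * colOp (lev L k) (fun _ : Fin (d + 1) => N₀) 1) (parT (lev L k) L (fun _ => N₀) X') q
        = (DH (fun _ : Fin (d + 1) => N₀) (L * lev L k) ν *ᵥ col (covOp (L * lev L k) (fun _ : Fin (d + 1) => N₀) 1 - covOp (lev L k) (fun _ : Fin (d + 1) => N₀) 1) q) X'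
          + ((DH (fun _ : Fin (d + 1) => N₀) (L * lev L k) ν - stairV (lev L k) L (fun _ : Fin (d + 1) => N₀) * DH (fun _ : Fin (d + 1) => N₀) (lev L k) ν)
              *ᵥ col (covOp (lev L k) (fun _ : Fin (d + 1) => N₀) 1) q) X' := by
      rw [← stairV_mul_apply (lev L k) L (fun _ : Fin (d + 1) => N₀) (fdiff (fine (lev L k) (fun _ => N₀)) ((lev L k : ℕ) : ℂ) ν * colOp (lev L k) (fun _ => N₀) 1) X' q,
        ← Matrix.sub_apply, fdiff_colOp_sub_eq, Matrix.add_apply, mul_apply_eq_mulVec_col, mul_apply_eq_mulVec_col]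
    rw [e]
    set E : ℝ := Real.exp (-(δm / 2 * torusSupNorm (fun _ : Fin (d + 1) => N₀)
      (rep (fun _ : Fin (d + 1) => N₀) (blockOf (L * lev L k) (fun _ : Fin (d + 1) => N₀) X'.1) - rep (fun _ : Fin (d + 1) => N₀) q.1))) with hE
    have hE0 : 0 ≤ E := (Real.exp_pos _).le
    calc _ ≤ ‖(DH (fun _ : Fin (d + 1) => N₀) (L * lev L k) ν *ᵥ col (covOp (L * lev L k) (fun _ : Fin (d + 1) => N₀) 1 - covOp (lev L k) (fun _ : Fin (d + 1) => N₀) 1) q) X'‖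
            + ‖((DH (fun _ : Fin (d + 1) => N₀) (L * lev L k) ν - stairV (lev L k) L (fun _ : Fin (d + 1) => N₀) * DH (fun _ : Fin (d + 1) => N₀) (lev L k) ν)
                *ᵥ col (covOp (lev L k) (fun _ : Fin (d + 1) => N₀) 1) q) X'‖ := norm_add_le _ _
      _ ≤ CH * (Kd * ε) * Λ * E + (d + 1) * (CG d (1/2) L * thetaG L (1/2) ^ k) * Kc * Λ * E := add_le_add hF1 hF2
      _ = (CH * Kd * ε + CK * Kc * thetaG L (1/2) ^ k) * (Λ * E) := by rw [hCK]; ring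
      _ ≤ (((CH * Kc + CH * Kd + CK * Kc) * Λ + 1) * (ε + thetaG L (1/2) ^ k)) * E := by
          have hS0 : 0 ≤ CH * Kc + CH * Kd + CK * Kc := by
            nlinarith [mul_nonneg hCH0 hKc.le, mul_nonneg hCH0 hKd.le, mul_nonneg hCK0 hKc.le]
          have h1 : CH * Kd * ε ≤ (CH * Kc + CH * Kd + CK * Kc) * ε := by
            apply mul_le_mul_of_nonneg_right _ hε0; nlinarith [mul_nonneg hCH0 hKc.le, mul_nonneg hCK0 hKc.le]
          have h2 : CK * Kc * thetaG L (1/2) ^ k ≤ (CH * Kc + CH * Kd + CK * Kc) * thetaG L (1/2) ^ k := by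
            apply mul_le_mul_of_nonneg_right _ hθ; nlinarith [mul_nonneg hCH0 hKc.le, mul_nonneg hCH0 hKd.le]
          have h3 : (CH * Kd * ε + CK * Kc * thetaG L (1/2) ^ k) * (Λ * E)
              ≤ ((CH * Kc + CH * Kd + CK * Kc) * (ε + thetaG L (1/2) ^ k)) * (Λ * E) := by
            apply mul_le_mul_of_nonneg_right _ (mul_nonneg hΛ0 hE0); linarith
          have h4 : ((CH * Kc + CH * Kd + CK * Kc) * (ε + thetaG L (1/2) ^ k)) * (Λ * E)
              = (((CH * Kc + CH * Kd + CK * Kc) * Λ) * (ε + thetaG L (1/2) ^ k)) * E := by ring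
          have h5 : (((CH * Kc + CH * Kd + CK * Kc) * Λ) * (ε + thetaG L (1/2) ^ k)) * E
              ≤ (((CH * Kc + CH * Kd + CK * Kc) * Λ + 1) * (ε + thetaG L (1/2) ^ k)) * E := by
            apply mul_le_mul_of_nonneg_right _ hE0
            apply mul_le_mul_of_nonneg_right _ (add_nonneg hε0 hθ)
            linarith
          linarith

end Cubic

end Summit.QuantumFields.BalabanUV.Beta.GAN24.SoftColumnGradKernelDecay

end
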